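import Summits.ResolutionOfSingularities.ResolutionOfSingularities.Theses.Valuative
import Summits.ResolutionOfSingularities.ResolutionOfSingularities.Theorems.ValuativeLuAlphaPTorsorMonogenicExit
import Summits.ResolutionOfSingularities.ResolutionOfSingularities.Theorems.ValuativeLuAlphaPTorsorPthPowerModMonomial
import Literature.FieldTheory.Separability.PIndependentDerivations
import Literature.AlgebraicGeometry.Resolution.RankOneReductionProofs

/-!
# `Valuative.LuAlphaPTorsor`, line `pfaff-line-log-final-forms`: the residue exit

Route `ResolutionOfSingularities/Valuative`, crux `LuAlphaPTorsor`
(stmt-ResolutionOfSingularities-0641), stub `stub_residueExit` of the lead's skeleton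
`Cruxes/LuAlphaPTorsor/Lines/pfaff-line-log-final-forms.lean`, PROVED here
(`stub_residueExit`, statement verbatim from the ledger registration).

**Statement.** `A₁ ⊆ O` a finitely generated `k`-subalgebra of the valued field `(K, O)`,
`char k = p`, regular at the centre `𝔭 = 𝔪_O ∩ A₁` (local ring `R = (A₁)_𝔭`), `t ∈ K` with
`t ^ p ∈ A₁` and `Frac (A₁[t]) = K`; `c, g, b ∈ A₁` with `b⁻¹ ∈ A₁`, `g ≠ 0` and
`t ^ p - c ^ p = g ^ p · b`, and for `θ := (t - c) / g` NO `z ∈ Frac A₁` has `ν(θ - z) < 1` (the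
residue of `θ` is not the residue of an element of `Frac A₁`: the "residue-transcendental"
exit of the value/residue/immediate trichotomy). Then some finitely generated `A ⊇ A₁` with
`t ∈ A ⊆ O`, `Frac A = K` is regular at the centre.

**Proof.** `θ ^ p = b` (characteristic `p`). The residue `b̄` of `b` in the residue field `κ`
of `R` is not a `p`-th power: if `b ≡ e ^ p mod 𝔪_R` with `e = a / s ∈ R`
(`a, s ∈ A₁`, `ν(s) = 1`), then `z := a / s ∈ Frac A₁` and
`(θ - z) ^ p = b - z ^ p ∈ 𝔪_R ⊆ 𝔪_O`, so `ν(θ - z) < 1`, excluded. Hence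
(`exists_derivation_isUnit_of_residue_ne_pow`, **residual richness of `Der_ℤ(R)`**) some
`ℤ`-derivation `δ` of `R` has `δ b` a unit: a derivation `D₀` of the field `κ` with
`D₀ b̄ = 1` vanishing on `κ ^ p` exists (Matsumura §26, tree
`exists_derivation_eq_one_eqOn_zero`), and `D₀ ∘ residue` expands on `{b}` in `ℤ`-derivations
of `R` (tree `exists_derivations_sum_eq`, through a presentation `k[X]_𝔮 ↠ R`):
`1 = D₀ b̄ = ∑_j \overline{Δ_j b} · n_j`, so some `Δ_j b ∉ 𝔪_R`. The monogenic exit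
(`stub_monogenicExit`, tree `ValuativeLuAlphaPTorsorMonogenicExit.lean`) applied to the images
of `c, g, b` in `R` and `δ` gives the model.
-/

set_option linter.dupNamespace false

namespace Summit.ResolutionOfSingularities.ResolutionOfSingularities.Theorems.PfaffLine

open IsLocalRing Literature.AlgebraicGeometry.Resolution Literature.FieldTheory.Separability

/-! ## Residual richness of `Der_ℤ(R)` -/

/-- **Residual richness of `Der_ℤ(R)`.** Let `Φq : k[X]_𝔮 ↠ R` present the regular local
ring `R`, `char k = p`, and let `u ∈ R` have residue which is not a `p`-th power in the
residue field `κ` of `R`. Then `δ u` is a unit for some `ℤ`-derivation `δ` of `R`: a derivation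
`D₀` of `κ` with `D₀ ū = 1` vanishing on `κ^p` (Matsumura §26) composed with the residue map is
a `residue`-derivation `R → κ`, which on `{u}` is a combination `∑_j \overline{Δ_j ·} n_j` of
`ℤ`-derivations of `R` (richness, `exists_derivations_sum_eq`); so some `Δ_j u ∉ 𝔪_R`.
[folklore] -/
theorem exists_derivation_isUnit_of_residue_ne_pow {k : Type} [Field k] {p : ℕ} (hp : p.Prime)
    [CharP k p] {n : ℕ} {R : Type} [CommRing R] [Algebra ℤ R] [IsRegularLocalRing R]
    (𝔮 : Ideal (MvPolynomial (Fin n) k)) [𝔮.IsPrime] (Φq : Localization.AtPrime 𝔮 →+* R)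
    (hsurj : Function.Surjective Φq) {u : R}
    (hu : ∀ e : R, IsLocalRing.residue R u ≠ IsLocalRing.residue R e ^ p) :
    ∃ δ : Derivation ℤ R R, IsUnit (δ u) := by
  classical
  haveI : Fact p.Prime := ⟨hp⟩
  let κ := ResidueField R
  -- `κ` has characteristic `p` (the composite `k → k[X]_𝔮 → R → κ` is a map of rings)
  haveI : CharP κ p := by
    have f : k →+* κ := ((residue R).comp Φq).comp (algebraMap k (Localization.AtPrime 𝔮))
    exact charP_of_injective_ringHom f.injective p
  -- the residue `ū` of `u` is not in `κ^p`
  set ū : κ := residue R u with hū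
  have hūF : ū ∉ pAdjoin p (∅ : Set κ) := by
    intro hmem
    have hcl : pAdjoin p (∅ : Set κ) = (frobenius κ p).fieldRange := by
      rw [pAdjoin, Set.union_empty]
      refine le_antisymm (Subfield.closure_le.mpr ?_) fun x hx => Subfield.subset_closure ?_
      · rintro x ⟨y, rfl⟩
        exact ⟨y, rfl⟩
      · obtain ⟨y, rfl⟩ := (RingHom.mem_fieldRange).mp hx
        exact ⟨y, rfl⟩
    rw [hcl] at hmem
    obtain ⟨z, hz⟩ := (RingHom.mem_fieldRange).mp hmem
    obtain ⟨e, rfl⟩ := residue_surjective z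
    exact hu e (by rw [← hz, frobenius_def])
  obtain ⟨D, hD1, -⟩ := exists_derivation_eq_one_eqOn_zero p (pAdjoin p (∅ : Set κ))
    (pow_mem_pAdjoin _) hūF
  -- restrict `D ∘ residue` to `R` and expand it in `ℤ`-derivations of `R`
  set ψ : R →+* κ := residue R with hψ
  let δ₀ : R →+ κ :=
    { toFun := fun x => D (ψ x)
      map_zero' := by simp only [map_zero]
      map_add' := fun x y => by simp only [map_add] }
  have hδ₀apply : ∀ x, δ₀ x = D (ψ x) := fun _ => rfl
  -- Leibniz for `D`, read off the term (the `ℤ`-algebra instance on `κ` is not canonical)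
  have hDl : ∀ x y : κ, D (x * y) = x • D y + y • D x :=
    @Derivation.leibniz ℤ κ κ _ _ _ (_) _ (_) D
  have hleib : ∀ x y, δ₀ (x * y) = ψ x * δ₀ y + ψ y * δ₀ x := by
    intro x y
    rw [hδ₀apply, hδ₀apply, hδ₀apply, map_mul, hDl, smul_eq_mul, smul_eq_mul]
  obtain ⟨m, Δ, nn, hsum⟩ :=
    exists_derivations_sum_eq k n 𝔮 Φq hsurj p κ ψ δ₀ hleib {u}
  have hsu := hsum u (Finset.mem_singleton_self u)
  by_contra hcon
  push Not at hcon
  have hzero : ∀ j, ψ (Δ j u) * nn j = 0 := fun j => by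
    have h0 : ψ (Δ j u) = 0 := by
      by_contra hne
      exact hcon (Δ j) ((residue_ne_zero_iff_isUnit _).mp hne)
    rw [h0, zero_mul]
  rw [Finset.sum_eq_zero (fun j _ => hzero j), hδ₀apply, ← hū, hD1] at hsu
  exact one_ne_zero hsu

/-! ## The stub -/

/-- **Stub `stub_residueExit` of the line `pfaff-line-log-final-forms`** (crux
`Valuative.LuAlphaPTorsor`, stmt-0641): the residue exit. Let `A₁ ⊆ O` be a finitely generated
model, regular at the centre, with `t ^ p ∈ A₁` and `Frac (A₁[t]) = K`, and `c, g, b ∈ A₁`,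
`b⁻¹ ∈ A₁`, `g ≠ 0`, `t ^ p - c ^ p = g ^ p · b`, such that no `z ∈ Frac A₁` has
`ν((t - c)/g - z) < 1`. Then the residue of `b` in the local ring `R = (A₁)_𝔭` of the centre
is not a `p`-th power, so `δ b` is a unit for some `ℤ`-derivation `δ` of `R` (residual
richness), and the monogenic exit `stub_monogenicExit` produces a finitely generated model
`A ⊇ A₁` with `t ∈ A ⊆ O`, `Frac A = K`, regular at the centre. -/
theorem stub_residueExit :
    ∀ p : ℕ, p.Prime → ∀ (k K : Type) [Field k] [CharP k p] [Field K] [Algebra k K] (O : ValuationSubring K) (A₁ : Subalgebra k K) (h₁ : A₁.toSubring ≤ O.toSubring) (t : K), A₁.FG → ∀ (htp : t ^ p ∈ A₁), IsFractionRing (Algebra.adjoin k (insert t (A₁ : Set K))) K → IsRegularLocalRing (Localization.AtPrime (Ideal.comap (Subring.inclusion h₁) (IsLocalRing.maximalIdeal O))) → ∀ (c g b : K), c ∈ A₁ → g ∈ A₁ → b ∈ A₁ → b⁻¹ ∈ A₁ → g ≠ 0 → t ^ p - c ^ p = g ^ p * b → (∀ z : K, z ∈ Subfield.closure (A₁ :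 Set K) → ¬ O.valuation ((t - c) / g - z) < 1) → ∃ (A : Subalgebra k K) (h : A.toSubring ≤ O.toSubring), A₁ ≤ A ∧ t ∈ A ∧ A.FG ∧ IsFractionRing A K ∧ IsRegularLocalRing (Localization.AtPrime (Ideal.comap (Subring.inclusion h) (IsLocalRing.maximalIdeal O))) := by
  intro p hp k K _ _ _ _ O A₁ h₁ t hfg htp hfr hreg c g b hc hg hb _ hg0 hrel hres
  classical
  haveI := Fact.mk hp
  haveI := hreg
  -- the centre `𝔭` of `O` on `A₁` and the embedding `φ : R = (A₁)_𝔭 → K`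
  set 𝔭 : Ideal A₁.toSubring := (maximalIdeal O).comap (Subring.inclusion h₁)
  have hunit : ∀ s : 𝔭.primeCompl, IsUnit (algebraMap A₁.toSubring K s) := fun s => by
    rw [isUnit_iff_ne_zero]
    intro h0
    apply s.2
    have : (s : A₁.toSubring) = 0 := Subtype.ext h0
    rw [this]
    exact 𝔭.zero_mem
  set φ : Localization.AtPrime 𝔭 →+* K := IsLocalization.lift hunit
  have hφa : ∀ a : A₁.toSubring, φ (algebraMap _ _ a) = a := fun a => IsLocalization.lift_eq hunit a
  have hφmk : ∀ (a : A₁.toSubring) (s : 𝔭.primeCompl), O.valuation ((s : A₁.toSubring) : K) = 1 ∧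
      φ (IsLocalization.mk' _ a s) = (a : K) * ((s : A₁.toSubring) : K)⁻¹ := by
    intro a s
    have hs1 : O.valuation ((s : A₁.toSubring) : K) = 1 :=
      (mem_primeCompl_centre_iff O A₁ h₁ s).mp s.2
    have hs0 : ((s : A₁.toSubring) : K) ≠ 0 := by
      intro h0
      rw [h0, map_zero] at hs1
      exact zero_ne_one hs1
    refine ⟨hs1, ?_⟩
    apply (IsLocalization.lift_mk'_spec hunit a _ s).mpr
    change (a : K) = ((s : A₁.toSubring) : K) * ((a : K) * ((s : A₁.toSubring) : K)⁻¹)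
    field_simp
  -- `φ(R) ⊆ Frac A₁` and `φ(𝔪_R) ⊆ 𝔪_O`
  have hφcl : ∀ r, φ r ∈ Subfield.closure (A₁ : Set K) := by
    intro r
    obtain ⟨⟨a, s⟩, rfl⟩ := IsLocalization.mk'_surjective 𝔭.primeCompl r
    obtain ⟨-, hr⟩ := hφmk a s
    rw [hr]
    exact mul_mem (Subfield.subset_closure a.2) (inv_mem (Subfield.subset_closure s.1.2))
  have hφmax : ∀ r ∈ maximalIdeal (Localization.AtPrime 𝔭), O.valuation (φ r) < 1 := by
    intro r hr
    obtain ⟨⟨a, s⟩, rfl⟩ := IsLocalization.mk'_surjective 𝔭.primeCompl r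
    obtain ⟨hs1, hr'⟩ := hφmk a s
    have ha : a ∈ 𝔭 := (IsLocalization.AtPrime.mk'_mem_maximal_iff _ 𝔭 a s).mp hr
    have ha1 : O.valuation (a : K) < 1 := by
      rw [Ideal.mem_comap, ValuationSubring.valuation_lt_one_iff] at ha
      exact ha
    rw [hr', map_mul, map_inv₀, hs1, inv_one, mul_one]
    exact ha1
  -- characteristic `p`; `θ := (t - c) / g` has `θ ^ p = b`
  haveI : CharP K p := charP_of_injective_algebraMap (algebraMap k K).injective p
  set θ : K := (t - c) / g with hθ
  have hθp : θ ^ p = b := by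
    rw [hθ, div_pow, sub_pow_char, hrel, mul_div_cancel_left₀ _ (pow_ne_zero _ hg0)]
  -- the images of `c, g, b` in `R`
  have hinj : Function.Injective (algebraMap A₁.toSubring (Localization.AtPrime 𝔭)) :=
    IsLocalization.injective (Localization.AtPrime 𝔭) 𝔭.primeCompl_le_nonZeroDivisors
  have hgR0 : algebraMap A₁.toSubring (Localization.AtPrime 𝔭) ⟨g, hg⟩ ≠ 0 := by
    intro h0
    apply hg0
    have : (⟨g, hg⟩ : A₁.toSubring) = 0 := hinj (by rw [h0, map_zero])
    exact congrArg Subtype.val this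
  have hrelA : (⟨t ^ p, htp⟩ : A₁.toSubring) - ⟨c, hc⟩ ^ p = ⟨g, hg⟩ ^ p * ⟨b, hb⟩ :=
    Subtype.ext (by push_cast; exact hrel)
  have hrelR : algebraMap A₁.toSubring (Localization.AtPrime 𝔭) ⟨t ^ p, htp⟩ -
      algebraMap A₁.toSubring (Localization.AtPrime 𝔭) ⟨c, hc⟩ ^ p =
      algebraMap A₁.toSubring (Localization.AtPrime 𝔭) ⟨g, hg⟩ ^ p *
        algebraMap A₁.toSubring (Localization.AtPrime 𝔭) ⟨b, hb⟩ := by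
    have := congrArg (algebraMap A₁.toSubring (Localization.AtPrime 𝔭)) hrelA
    rwa [map_sub, map_pow, map_mul, map_pow] at this
  -- the residue of `b` is not a `p`-th power
  have hbR : ∀ e : Localization.AtPrime 𝔭,
      residue _ (algebraMap A₁.toSubring (Localization.AtPrime 𝔭) ⟨b, hb⟩) ≠ residue _ e ^ p := by
    intro e he
    have hmem : algebraMap A₁.toSubring (Localization.AtPrime 𝔭) ⟨b, hb⟩ - e ^ p ∈
        maximalIdeal (Localization.AtPrime 𝔭) := by
      rw [← residue_eq_zero_iff, map_sub, map_pow, he, sub_self]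
    have hlt := hφmax _ hmem
    rw [map_sub, map_pow, hφa] at hlt
    apply hres (φ e) (hφcl e)
    have hpow : (θ - φ e) ^ p = b - φ e ^ p := by rw [sub_pow_char, hθp]
    refine lt_of_pow_lt_pow_left' p ?_
    rw [one_pow, ← map_pow, hpow]
    exact hlt
  -- residual richness: a `ℤ`-derivation `δ` of `R` with `δ b` a unit
  obtain ⟨n, Φ, hΦ⟩ := exists_presentation O A₁ h₁ hfg
  obtain ⟨Φq, hsurj, -⟩ := exists_surjective_lift Φ hΦ
  obtain ⟨δ, hδ⟩ := exists_derivation_isUnit_of_residue_ne_pow hp _ Φq hsurj hbR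
  -- the monogenic exit
  exact stub_monogenicExit p hp k K O A₁ h₁ t hfg htp hfr hreg
    ⟨_, _, _, δ, hgR0, hrelR, hδ⟩

end Summit.ResolutionOfSingularities.ResolutionOfSingularities.Theorems.PfaffLine
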